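import Mathlib.Analysis.Calculus.FDeriv.Equiv
import Mathlib.Analysis.Normed.Module.Ball.Pointwise
import Mathlib.MeasureTheory.Measure.Haar.NormedSpace
import Literature.Analysis.FluidPDE.VectorCalculus
import Literature.Analysis.FunctionSpaces.LittlewoodPaleyKernel
import Summits.NavierStokesRegularity.NavierStokesRegularity.Theorems.TypeILiouvilleTypeIliouvilleNoTypeIIStubThreeFifthsLawCurl
import HarnessLib

/-!
# Route `TautLoopKelvin`, crux `CirculationFloor` (stmt-NavierStokesRegularity-1538), line `birth`:
  stub `stub_blockScaling` (dyadic scaling of the circulation Bernstein inequality)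

**Statement.** Suppose the unit-scale inequality holds with constants `C > 0`, `0 < θ ≤ 1`: for
every smooth divergence-free `v : ℝ³ → ℝ³` with bounded derivatives of all orders and every
`ε ≥ 0`, coordinate vorticity fluxes `|∫_{B_θ(x)} ⟪curl v, e_m⟫| ≤ 2θε` through all balls
of radius `θ` force `‖(Δ̇₀ v)(x)‖ ≤ C ε` everywhere (`Δ̇₀ v = blockFn 0 v = K₀ ⋆ v`). Then for
every such `v`, every `j : ℕ` and `ε ≥ 0`, fluxes `≤ 2(θ2^{-j})ε` through all balls of radius
`θ 2^{-j}` force `‖(Δ̇_j v)(x)‖ ≤ C 2^j ε` everywhere.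

**Proof** (dilation, KNOWN MECHANISM). Put `b = 2^j` and `w(y) = v(b⁻¹ y)`. Then `w` is
smooth, has bounded derivatives of all orders (`Dⁿ(v ∘ g) = Dⁿv ∘ (g, …, g)` for the linear
map `g = b⁻¹ • id`, Mathlib `ContinuousLinearMap.iteratedFDeriv_comp_right`), is divergence
free and `curl w (y) = b⁻¹ (curl v)(b⁻¹ y)` (chain rule; tree `isDivFree_comp_smul`,
`curl_comp_smul`). Substituting `z = b⁻¹ y` in the ball integral (Mathlib
`Measure.setIntegral_comp_smul_of_pos`, `smul_ball`) gives
`∫_{B_θ(x)} ⟪curl w, e_m⟫ = b⁻¹ · b³ · ∫_{B_{θ/b}(x/b)} ⟪curl v, e_m⟫`, of modulus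
`≤ b² · 2(θ/b)ε = 2θ(bε)`; so the unit-scale statement applies to `w` with `ε' = b ε` and
yields `‖Δ̇₀ w‖_∞ ≤ C b ε`. Finally `(Δ̇_j v)(x) = (Δ̇₀ w)(b x)` by the dyadic scaling of the
kernel `K_j = 2^{3j} K₀(2^j ·)` (tree `blockKernel_eq_scale`) and the substitution `s = b t`
in the convolution integral (Mathlib `Measure.integral_comp_smul`, no integrability needed).

Sources: H. Bahouri, J.-Y. Chemin, R. Danchin, *Fourier Analysis and Nonlinear PDE*
(Springer 2011), §2.2 (proof of Lemma 2.1: `Δ̇_j u = 2^{jd} h(2^j ·) ⋆ u`); standard.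
-/

noncomputable section

open Set MeasureTheory Filter Topology Function Metric
open scoped ENNReal NNReal RealInnerProductSpace
open Literature.Analysis.FluidPDE Literature.Analysis.FunctionSpaces
open Summit.NavierStokesRegularity.NavierStokesRegularity.Theorems.TypeIliouvilleNoTypeII

namespace Summit.NavierStokesRegularity.NavierStokesRegularity.Theorems.CirculationFloor.Birth

-- the problem-side namespace `Summit.NavierStokesRegularity.NavierStokesRegularity.…` (summit =
-- problem for this single-problem summit) duplicates `NavierStokesRegularity` by design
set_option linter.dupNamespace false

/-! ### Dilations preserve "bounded derivatives of all orders" -/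

/-- **Derivatives of a dilation are bounded**: if every derivative of the smooth field `v` is
bounded, so is every derivative of `y ↦ v (a y)` (`Dⁿ(v ∘ g)(y) = Dⁿv(g y) ∘ (g, …, g)` for the
continuous linear map `g = a • id`, and `‖M ∘ (g, …, g)‖ ≤ ‖M‖ ∏ ‖g‖`). -/
theorem scaling_iteratedFDeriv_comp_smul_bounded
    {v : EuclideanSpace ℝ (Fin 3) → EuclideanSpace ℝ (Fin 3)} (hv : ContDiff ℝ (⊤ : ℕ∞) v)
    (hB : ∀ n : ℕ, ∃ B : ℝ, ∀ x, ‖iteratedFDeriv ℝ n v x‖ ≤ B) (a : ℝ) :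
    ∀ n : ℕ, ∃ B : ℝ, ∀ x, ‖iteratedFDeriv ℝ n (fun y => v (a • y)) x‖ ≤ B := by
  intro n
  obtain ⟨B, hBn⟩ := hB n
  set g : EuclideanSpace ℝ (Fin 3) →L[ℝ] EuclideanSpace ℝ (Fin 3) :=
    a • ContinuousLinearMap.id ℝ (EuclideanSpace ℝ (Fin 3)) with hg
  have hfg : (fun y => v (a • y)) =
      v ∘ (g : EuclideanSpace ℝ (Fin 3) → EuclideanSpace ℝ (Fin 3)) := by
    funext y
    simp [hg]
  have hvn : ContDiff ℝ n v := contDiff_infty.1 hv n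
  refine ⟨B * ∏ _i : Fin n, ‖g‖, fun x => ?_⟩
  rw [hfg, g.iteratedFDeriv_comp_right hvn x le_rfl]
  calc ‖(iteratedFDeriv ℝ n v (g x)).compContinuousLinearMap fun _ => g‖
      ≤ ‖iteratedFDeriv ℝ n v (g x)‖ * ∏ _i : Fin n, ‖g‖ :=
        ContinuousMultilinearMap.norm_compContinuousLinearMap_le _ _
    _ ≤ B * ∏ _i : Fin n, ‖g‖ :=
        mul_le_mul_of_nonneg_right (hBn _) (Finset.prod_nonneg fun _ _ => norm_nonneg _)

/-! ### Substitution in ball integrals -/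

/-- **Dilating a ball integral** in `ℝ³`: `∫_{B_r(x)} f(a y) dy = a⁻³ ∫_{B_{ar}(a x)} f(z) dz`
for `a > 0` (Mathlib `Measure.setIntegral_comp_smul_of_pos` and `smul_ball`). -/
theorem scaling_setIntegral_ball_comp_smul (f : EuclideanSpace ℝ (Fin 3) → ℝ) {a : ℝ}
    (ha : 0 < a) (x : EuclideanSpace ℝ (Fin 3)) (r : ℝ) :
    ∫ y in ball x r, f (a • y) = (a ^ 3)⁻¹ * ∫ z in ball (a • x) (a * r), f z := by
  rw [Measure.setIntegral_comp_smul_of_pos volume f (ball x r) ha, _root_.smul_ball ha.ne',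
    Real.norm_eq_abs, abs_of_pos ha, finrank_euclideanSpace_fin, smul_eq_mul]

/-- **Vorticity fluxes of a dilation**: for `b > 0` and `w = v(b⁻¹ ·)`,
`∫_{B_r(x)} ⟪curl w, e⟫ = b⁻¹ (b⁻¹)⁻³ ∫_{B_{r/b}(x/b)} ⟪curl v, e⟫`. -/
theorem scaling_ballFlux_comp_inv_smul
    (v : EuclideanSpace ℝ (Fin 3) → EuclideanSpace ℝ (Fin 3)) {b : ℝ} (hb : 0 < b)
    (x e : EuclideanSpace ℝ (Fin 3)) (r : ℝ) :
    ∫ y in ball x r, ⟪curl (fun y => v (b⁻¹ • y)) y, e⟫ =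
      b⁻¹ * (((b⁻¹) ^ 3)⁻¹ * ∫ z in ball (b⁻¹ • x) (b⁻¹ * r), ⟪curl v z, e⟫) := by
  have hb' : 0 < b⁻¹ := inv_pos.2 hb
  simp_rw [GradientPivot.curl_comp_smul v b⁻¹, real_inner_smul_left]
  rw [integral_const_mul, scaling_setIntegral_ball_comp_smul (fun z => ⟪curl v z, e⟫) hb' x r]

/-! ### Dyadic scaling of the blocks -/

/-- **`(Δ̇_j v)(x) = (Δ̇₀ w)(2^j x)` for `w = v(2^{-j} ·)`**: the kernel scales as
`K_j(t) = 2^{3j} K₀(2^j t)` (`blockKernel_eq_scale`), and the substitution `s = 2^j t` in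
`(Δ̇_j v)(x) = ∫ K_j(t) v(x - t) dt` (Mathlib `Measure.integral_comp_smul`, valid without
integrability hypotheses) gives `∫ K₀(s) v(x - 2^{-j}s) ds = (Δ̇₀ w)(2^j x)`. -/
theorem scaling_blockFn_natCast_eq (v : EuclideanSpace ℝ (Fin 3) → EuclideanSpace ℝ (Fin 3))
    (j : ℕ) (x : EuclideanSpace ℝ (Fin 3)) :
    blockFn (j : ℤ) v x = blockFn 0 (fun y => v (((2 : ℝ) ^ j)⁻¹ • y)) ((2 : ℝ) ^ j • x) := by
  set b : ℝ := (2 : ℝ) ^ j with hb_def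
  have hb : 0 < b := pow_pos two_pos j
  have hb3 : 0 < b ^ 3 := pow_pos hb 3
  rw [blockFn_apply, blockFn_apply]
  have hK : ∀ t : EuclideanSpace ℝ (Fin 3), blockKernel (EuclideanSpace ℝ (Fin 3)) (j : ℤ) t =
      b ^ 3 * blockKernel (EuclideanSpace ℝ (Fin 3)) 0 (b • t) := by
    intro t
    rw [blockKernel_eq_scale, finrank_euclideanSpace_fin, ← Nat.cast_mul, zpow_natCast,
      zpow_natCast, pow_mul]
  simp_rw [hK]
  have h := Measure.integral_comp_smul volume
    (fun s : EuclideanSpace ℝ (Fin 3) =>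
      (b ^ 3 * blockKernel (EuclideanSpace ℝ (Fin 3)) 0 s) • v (x - b⁻¹ • s)) b
  simp only [smul_smul, inv_mul_cancel₀ hb.ne', one_smul] at h
  rw [h, finrank_euclideanSpace_fin, abs_of_pos (inv_pos.2 hb3), ← integral_smul]
  congr 1
  funext s
  rw [smul_smul, ← mul_assoc, inv_mul_cancel₀ hb3.ne', one_mul, smul_sub, smul_smul,
    inv_mul_cancel₀ hb.ne', one_smul]

/-! ### The registered stub -/

/-- **stub S — `stub_blockScaling` (dyadic scaling, KNOWN MECHANISM).** The unit-scale
circulation Bernstein inequality with constants `(C, θ)` implies the inequality at every dyadic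
scale `j`: fluxes `≤ 2(θ2^{-j})ε` through all balls of radius `θ 2^{-j}` give
`‖(Δ̇_j v)(x)‖ ≤ C 2^j ε` (apply the hypothesis to `w = v(2^{-j}·)` with `ε' = 2^j ε`:
`(Δ̇_j v)(x) = (Δ̇₀ w)(2^j x)` by `blockKernel_eq_scale`, `curl w = 2^{-j}(curl v)(2^{-j}·)`,
and the ball integral rescales by `2^{3j}`). -/
theorem stub_blockScaling :
    ∀ (C θ : ℝ), 0 < C → 0 < θ → θ ≤ 1 →
      (∀ (v : EuclideanSpace ℝ (Fin 3) → EuclideanSpace ℝ (Fin 3)), ContDiff ℝ (⊤ : ℕ∞) v →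
        (∀ n : ℕ, ∃ B : ℝ, ∀ x, ‖iteratedFDeriv ℝ n v x‖ ≤ B) →
        Literature.Analysis.FluidPDE.VectorCalculus.IsDivFree v →
        ∀ ε : ℝ, 0 ≤ ε →
          (∀ (x : EuclideanSpace ℝ (Fin 3)) (m : Fin 3),
            |∫ y in Metric.ball x θ, inner ℝ (Literature.Analysis.FluidPDE.curl v y)
              (EuclideanSpace.single m (1 : ℝ))| ≤ 2 * θ * ε) →
          ∀ x : EuclideanSpace ℝ (Fin 3), ‖Literature.Analysis.FunctionSpaces.blockFn 0 v x‖ ≤ C * ε) →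
      ∀ (v : EuclideanSpace ℝ (Fin 3) → EuclideanSpace ℝ (Fin 3)), ContDiff ℝ (⊤ : ℕ∞) v →
        (∀ n : ℕ, ∃ B : ℝ, ∀ x, ‖iteratedFDeriv ℝ n v x‖ ≤ B) →
        Literature.Analysis.FluidPDE.VectorCalculus.IsDivFree v →
        ∀ (j : ℕ) (ε : ℝ), 0 ≤ ε →
          (∀ (x : EuclideanSpace ℝ (Fin 3)) (m : Fin 3),
            |∫ y in Metric.ball x (θ * (2 : ℝ) ^ (-(j : ℤ))),
              inner ℝ (Literature.Analysis.FluidPDE.curl v y) (EuclideanSpace.single m (1 : ℝ))| ≤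
                2 * (θ * (2 : ℝ) ^ (-(j : ℤ))) * ε) →
          ∀ x : EuclideanSpace ℝ (Fin 3),
            ‖Literature.Analysis.FunctionSpaces.blockFn (j : ℤ) v x‖ ≤ C * (2 : ℝ) ^ j * ε := by
  intro C θ hC hθ hθ1 hUnit v hv hB hdiv j ε hε hflux x
  -- the scale `b = 2^j` and the dilated field `w = v(b⁻¹ ·)`
  set b : ℝ := (2 : ℝ) ^ j with hb_def
  have hb : 0 < b := pow_pos two_pos j
  have hzpow : (2 : ℝ) ^ (-(j : ℤ)) = b⁻¹ := by
    rw [zpow_neg, zpow_natCast]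
  rw [hzpow] at hflux
  set w : EuclideanSpace ℝ (Fin 3) → EuclideanSpace ℝ (Fin 3) := fun y => v (b⁻¹ • y)
    with hw_def
  -- hypotheses of the unit-scale statement for `w`
  have hw_smooth : ContDiff ℝ (⊤ : ℕ∞) w := hv.comp (contDiff_const_smul b⁻¹)
  have hw_bdd : ∀ n : ℕ, ∃ B : ℝ, ∀ x, ‖iteratedFDeriv ℝ n w x‖ ≤ B :=
    scaling_iteratedFDeriv_comp_smul_bounded hv hB b⁻¹
  have hw_div : VectorCalculus.IsDivFree w := GradientPivot.isDivFree_comp_smul hdiv b⁻¹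
  have hw_flux : ∀ (x : EuclideanSpace ℝ (Fin 3)) (m : Fin 3),
      |∫ y in ball x θ, ⟪curl w y, EuclideanSpace.single m (1 : ℝ)⟫| ≤ 2 * θ * (b * ε) := by
    intro x' m
    rw [hw_def, scaling_ballFlux_comp_inv_smul v hb x' (EuclideanSpace.single m (1 : ℝ)) θ,
      abs_mul, abs_mul, abs_of_pos (inv_pos.2 hb),
      abs_of_pos (inv_pos.2 (pow_pos (inv_pos.2 hb) 3)), mul_comm b⁻¹ θ]
    have h := hflux (b⁻¹ • x') m
    have hbb : b⁻¹ * b = 1 := inv_mul_cancel₀ hb.ne'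
    calc b⁻¹ * ((b⁻¹ ^ 3)⁻¹ * |∫ z in ball (b⁻¹ • x') (θ * b⁻¹),
          ⟪curl v z, EuclideanSpace.single m (1 : ℝ)⟫|)
        ≤ b⁻¹ * ((b⁻¹ ^ 3)⁻¹ * (2 * (θ * b⁻¹) * ε)) := by gcongr
      _ = b⁻¹ * (b ^ 3 * (2 * (θ * b⁻¹) * ε)) := by rw [inv_pow, inv_inv]
      _ = (b⁻¹ * b) * (b⁻¹ * b) * (2 * θ * (b * ε)) := by ring
      _ = 2 * θ * (b * ε) := by rw [hbb, one_mul, one_mul]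
  -- the unit-scale statement for `w` with `ε' = b ε`, read at the point `b • x`
  have hunit : ‖blockFn 0 w (b • x)‖ ≤ C * (b * ε) :=
    hUnit w hw_smooth hw_bdd hw_div (b * ε) (by positivity) hw_flux (b • x)
  have key : blockFn (j : ℤ) v x = blockFn 0 w (b • x) := scaling_blockFn_natCast_eq v j x
  rw [key, mul_assoc]
  exact hunit

end Summit.NavierStokesRegularity.NavierStokesRegularity.Theorems.CirculationFloor.Birth
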